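import Mathlib
import Summits.NavierStokesRegularity.NavierStokesRegularity.Theorems.SubOnsagerCeilingDefs
import Summits.NavierStokesRegularity.NavierStokesRegularity.Theorems.OrthantWakeDyadicBreakBelowOneOfCruxes
import Summits.NavierStokesRegularity.NavierStokesRegularity.Theorems.SubOnsagerCeilingSideBranchChainDrive
import HarnessLib

/-!
# Route SubOnsagerCeiling — the crux `ForwardTailCeilingKP` implies the one-mode item `DyadicTailCeiling` BY NAME
# (helper file, def-free; `--supports` the crux `ForwardTailCeilingKP`, stmt-NavierStokesRegularity-27057)

`dyadicTailCeiling_of_forwardTailCeilingKP : ForwardTailCeilingKP → DyadicTailCeiling`.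

The crux (stmt-27057) asserts, for every `R ≥ 1`, every scale ratio `1+ε₀ ∈ (1,2]` and every KP network
proper `α ∈ E₂(R)` (orthant, diagonal feeds), a ν-uniform sub-Onsager ceiling on the FORWARD-SOURCE partial
tails `Σ_{k=n..N} Σ_{i∈S} ½X_{i,k}²`, `S ⊇ S⁺(α)`.  The scalar Katz–Pavlović table `dyadicTable` is such a network
(`dyadicTable ∈ E₂(2)`: `inTableClass_dyadicTable`; orthant: `dyadicSocket_kamke`; its only feed `0 → 0` is
diagonal), its single forward source is the chain mode `0` (so `0 ∈ S`), and its three other components are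
IDLE: `quadTerm ε₀ dyadicTable X i ≡ 0` for `i ≠ 0` (`quadTerm_dyadicTable_of_ne`), so along an honest viscous
solution they obey `Ẋ_{i,k} = −ν(1+ε₀)^{2k}X_{i,k}`, hence `X_{i,k}(t)² ≤ X_{i,k}(0)²`
(`dyadicIdle_sq_le`): they vanish on every shell `k ≥ 1` and never exceed the datum on shell `0`.  Therefore
the TOTAL tails of the route's aside item `DyadicTailCeiling` (stmt-25511: all four components) are bounded by
the crux's forward-source tails plus at most `E₀` on the datum shell: `DyadicTailCeiling` holds with the crux's
`θ` and the constant `C + 1`.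

So the by-name map of this crux is now closed on the one-mode side: `ForwardTailCeilingKP ⇒ DyadicTailCeiling`
(this file) while `DyadicTailCeiling` at a ratio is EQUIVALENT to the chain corner of both registered stubs at
that ratio (`dyadicTailCeilingAt_of_shellBarrierAt`, p834119; `shellBarrierAt_scaledDyadic_of_dyadicTailCeilingAt`,
p834216), is PROVED at every `ε₀ ∈ [9/25, 1]` (`dyadicTailCeilingAt_largeRatio`) and REDUCED to `ε₀ ∈ (0, 9/25)`
(`dyadicTailCeiling_of_smallRatio`) — the crux is at least as hard as the λ-uniform one-mode problem on
`b ∈ (1, 1.36)`, kernel-checked by name.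

HONEST FRAMING: bookkeeping on a MODEL lattice ODE (route SubOnsagerCeiling, rung TL-M2Break); an implication
between two OPEN route declarations plus elementary real analysis (sign/monotonicity of a linear ODE within
`[0,s]`); no stub, crux or summit is proved here and nothing in this file bears on Navier–Stokes regularity.
[cite: Tao2016AveragedNS, §4 (4.2)–(4.3), (4.8), §1.2 (the dyadic Katz–Pavlović system)].
-/

noncomputable section

-- the sub-problem namespace `NavierStokesRegularity.NavierStokesRegularity` is the tree's layout (D-0017)
set_option linter.dupNamespace false

namespace Summit.NavierStokesRegularity.NavierStokesRegularity.Theorems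

open Set
open Literature.Analysis.FluidPDE.TaoCascade
open Summit.NavierStokesRegularity.NavierStokesRegularity.Theses.SubOnsagerCeiling
open Summit.NavierStokesRegularity.NavierStokesRegularity.Theorems.SubOnsagerCeiling

/-- **Idle components decay.** Along an honest `ν`-viscous solution (`ν ≥ 0`) of the `dyadicTable` lattice on
`[0,s]`, every component `i ≠ 0` satisfies `X_{i,k}(t)² ≤ X_{i,k}(0)²` for `t ∈ [0,s]`: its nonlinearity
vanishes (`quadTerm_dyadicTable_of_ne`), so `d/dt X² = −2ν(1+ε₀)^{2k}X² ≤ 0`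
(`sideBranch_le_of_deriv_nonneg` applied to `−X²`). [this file] -/
theorem dyadicIdle_sq_le {ε₀ ν s : ℝ} (hν : 0 ≤ ν) (hb : 0 < 1 + ε₀) {X : Fin 4 → ℤ → ℝ → ℝ}
    (hode : ∀ (i : Fin 4) (k : ℤ), ∀ t ∈ Set.Icc (0 : ℝ) s, HasDerivWithinAt (X i k)
      (quadTerm ε₀ dyadicTable X i k t - ν * (1 + ε₀) ^ ((2 : ℝ) * k) * X i k t) (Set.Icc (0 : ℝ) s) t)
    {i : Fin 4} (hi : i ≠ 0) (k : ℤ) {t : ℝ} (ht : t ∈ Set.Icc (0 : ℝ) s) :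
    X i k t ^ 2 ≤ X i k 0 ^ 2 := by
  have hw : 0 ≤ ν * (1 + ε₀) ^ ((2 : ℝ) * k) := mul_nonneg hν (Real.rpow_pos_of_pos hb _).le
  -- `Φ = -X²` has derivative `2ν(1+ε₀)^{2k} X² ≥ 0` within `[0,s]`
  have hder : ∀ u ∈ Icc (0 : ℝ) s, HasDerivWithinAt (fun u => -(X i k u ^ 2))
      (2 * (ν * (1 + ε₀) ^ ((2 : ℝ) * k)) * X i k u ^ 2) (Icc (0 : ℝ) s) u := by
    intro u hu
    have h1 := hode i k u hu
    rw [quadTerm_dyadicTable_of_ne ε₀ X hi, zero_sub] at h1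
    have h2 := (h1.pow 2).neg
    refine h2.congr_deriv ?_
    push_cast
    ring
  have hle := sideBranch_le_of_deriv_nonneg hder (fun u _ => by positivity) ht
  simpa using hle

/-- **The crux `ForwardTailCeilingKP` implies the one-mode item `DyadicTailCeiling` (stmt-25511)**, with the
crux's exponent `θ` and the constant `C + 1`: instantiate the crux at `R = 2`, `α = dyadicTable`
(`inTableClass_dyadicTable`, `dyadicSocket_kamke`, `dyadicTable_diagonalFeed`); the returned set `S` contains
the chain mode `0` (`zero_mem_of_sourceComplete_dyadicTable`, both from `…DyadicBreakBelowOneOfCruxes.lean`, whose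
`dyadicBreakBelowOne_of_forwardTailCeilingKP` is the sibling implication 27057 ⇒ 24644); the components off `S` are idle and contribute at most the datum
energy on shell `0` (`dyadicIdle_sq_le`) and nothing on shells `≥ 1`. MODEL lattice statement. [this file] -/
theorem dyadicTailCeiling_of_forwardTailCeilingKP (hK : ForwardTailCeilingKP) : DyadicTailCeiling := by
  intro ε₀ h0 hle
  obtain ⟨S, hS, θ, hθ, C, hC, H⟩ := hK 2 (by norm_num) ε₀ h0 hle dyadicTable
    (inTableClass_dyadicTable le_rfl) dyadicSocket_kamke dyadicTable_diagonalFeed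
  have hb : (0 : ℝ) < 1 + ε₀ := by linarith
  -- the chain mode is a forward source, hence in `S`; so every `i ∉ S` is idle
  have h0S : (0 : Fin 4) ∈ S := zero_mem_of_sourceComplete_dyadicTable hS
  refine ⟨θ, hθ, C + 1, by positivity, ?_⟩
  intro ν hν X₀ s hs X hdat hvan hbdd hcont hode hnn n N hnN t ht
  set E₀ : ℝ := ∑ j : Fin 4, (1 / 2 : ℝ) * X₀ j ^ 2 with hE₀
  have hE₀0 : 0 ≤ E₀ := Finset.sum_nonneg fun j _ => by positivity
  have hr : 0 < (1 + ε₀) ^ (-(2 * θ * (n : ℝ))) := Real.rpow_pos_of_pos hb _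
  -- the forward-source part, from the crux
  have hSrc := H ν hν X₀ s hs X hdat hvan hbdd hcont hode hnn n N hnN t ht
  -- the idle part: termwise `½X_{i,k}(t)² ≤ ½X_{i,k}(0)²`, and `X_{i,k}(0) = 0` unless `k = 0`
  have hidle : ∀ i ∈ Sᶜ, ∀ k : ℕ,
      (1 / 2 : ℝ) * X i (k : ℤ) t ^ 2 ≤ if k = 0 then (1 / 2 : ℝ) * X₀ i ^ 2 else 0 := by
    intro i hi k
    have hi0 : i ≠ 0 := by
      intro h; rw [Finset.mem_compl, h] at hi; exact hi h0S
    have h1 := dyadicIdle_sq_le hν.le hb hode hi0 (k : ℤ) ht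
    rw [hdat i k] at h1
    by_cases hk : k = 0
    · subst hk
      simp only [Nat.cast_zero, if_true] at h1 ⊢
      linarith
    · have hk' : (k : ℤ) ≠ 0 := by exact_mod_cast hk
      simp only [hk', if_false, hk] at h1 ⊢
      nlinarith [sq_nonneg (X i (k : ℤ) t)]
  have hIdle : ∑ k ∈ Finset.Icc n N, ∑ i ∈ Sᶜ, (1 / 2 : ℝ) * X i (k : ℤ) t ^ 2 ≤
      E₀ * (1 + ε₀) ^ (-(2 * θ * (n : ℝ))) := by
    rcases Nat.eq_zero_or_pos n with hn0 | hnpos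
    · -- `n = 0`: only the datum shell contributes, at most `E₀`, and the weight is `1`
      subst hn0
      have hw1 : (1 + ε₀) ^ (-(2 * θ * ((0 : ℕ) : ℝ))) = 1 := by simp
      rw [hw1, mul_one]
      calc ∑ k ∈ Finset.Icc 0 N, ∑ i ∈ Sᶜ, (1 / 2 : ℝ) * X i (k : ℤ) t ^ 2
          ≤ ∑ k ∈ Finset.Icc 0 N, ∑ i ∈ Sᶜ, (if k = 0 then (1 / 2 : ℝ) * X₀ i ^ 2 else 0) :=
            Finset.sum_le_sum fun k _ => Finset.sum_le_sum fun i hi => hidle i hi k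
        _ = ∑ k ∈ Finset.Icc 0 N, (if k = 0 then ∑ i ∈ Sᶜ, (1 / 2 : ℝ) * X₀ i ^ 2 else 0) := by
            refine Finset.sum_congr rfl fun k _ => ?_
            split_ifs <;> simp
        _ = ∑ i ∈ Sᶜ, (1 / 2 : ℝ) * X₀ i ^ 2 := by
            rw [Finset.sum_ite_eq']
            simp
        _ ≤ E₀ := by
            rw [hE₀]
            exact Finset.sum_le_univ_sum_of_nonneg fun j => by positivity
    · -- `n ≥ 1`: every idle term vanishes
      have hz : ∑ k ∈ Finset.Icc n N, ∑ i ∈ Sᶜ, (1 / 2 : ℝ) * X i (k : ℤ) t ^ 2 ≤ 0 := by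
        refine Finset.sum_nonpos fun k hk => ?_
        have hk0 : k ≠ 0 := by
          have := (Finset.mem_Icc.mp hk).1; omega
        calc ∑ i ∈ Sᶜ, (1 / 2 : ℝ) * X i (k : ℤ) t ^ 2
            ≤ ∑ i ∈ Sᶜ, (if k = 0 then (1 / 2 : ℝ) * X₀ i ^ 2 else 0) :=
              Finset.sum_le_sum fun i hi => hidle i hi k
          _ = 0 := by simp [hk0]
      exact hz.trans (by positivity)
  -- assemble
  have hsplit : ∀ k : ℕ, ∑ i : Fin 4, (1 / 2 : ℝ) * X i (k : ℤ) t ^ 2 =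
      ∑ i ∈ S, (1 / 2 : ℝ) * X i (k : ℤ) t ^ 2 + ∑ i ∈ Sᶜ, (1 / 2 : ℝ) * X i (k : ℤ) t ^ 2 :=
    fun k => (Finset.sum_add_sum_compl S _).symm
  calc ∑ k ∈ Finset.Icc n N, ∑ i : Fin 4, (1 / 2 : ℝ) * X i (k : ℤ) t ^ 2
      = ∑ k ∈ Finset.Icc n N, ∑ i ∈ S, (1 / 2 : ℝ) * X i (k : ℤ) t ^ 2 +
          ∑ k ∈ Finset.Icc n N, ∑ i ∈ Sᶜ, (1 / 2 : ℝ) * X i (k : ℤ) t ^ 2 := by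
        rw [← Finset.sum_add_distrib]
        exact Finset.sum_congr rfl fun k _ => hsplit k
    _ ≤ C * E₀ * (1 + ε₀) ^ (-(2 * θ * (n : ℝ))) + E₀ * (1 + ε₀) ^ (-(2 * θ * (n : ℝ))) :=
        add_le_add hSrc hIdle
    _ = (C + 1) * E₀ * (1 + ε₀) ^ (-(2 * θ * (n : ℝ))) := by ring

end Summit.NavierStokesRegularity.NavierStokesRegularity.Theorems

end
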